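import Literature.Probability.RandomPlanarGeometry.HexSAWStripSurfaceLimits
import HarnessLib

/-!
# `y_T` is the radius of convergence of the `y`-series `B_T(x_c; y)`

Topic `Literature/Probability/RandomPlanarGeometry` (continues the capstone `HexSAWSurfaceFugacity.lean` — `HV.stripBddSet T`,
`HV.stripYT T := sSup (stripBddSet T)`, the LANE DEFINITION of `y_T` as a boundedness threshold — and `HexSAWStripSurfaceLimits.lean`:
`HV.stripByLim T y := sup_L B_{T,L}(x_c; y)`).

The capstone's docstring reads `stripYT T` as BBdGDCG14's `y_T` through «sup of the boundedness set = radius in `y` of `B_T(x_c; ·)`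
(nonnegative coefficients)».  This file formalises exactly that reading.  Write `B_{T,L}(x_c; y) = Σ_m β_{T,L,m} y^m`
(`HV.stripBcoeffY`, `HV.hasSum_stripBcoeffY`), let `β_{T,m} := sup_L β_{T,L,m}` (`HV.stripBcoeff`; the coefficients increase with `L`)
and `B_T(x_c; y) := Σ_m β_{T,m} y^m`.  Then for `T ≥ 1`:

* `HV.hasSum_stripBcoeff_of_mem` — on the boundedness set the series converges, with sum `HV.stripByLim T y`;
* `HV.not_summable_stripBcoeff` — off it (for `y ≥ 0`) the series diverges;
* **`HV.stripBddSet_eq_summable`** — `stripBddSet T = {y ≥ 0 : Σ_m β_{T,m} y^m < ∞}`;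
* **`HV.stripYT_eq_sSup_summable`** — `y_T = sup {y ≥ 0 : Σ_m β_{T,m} y^m converges}`, i.e. `y_T` IS the radius of convergence of
  the `y`-series `B_T(x_c; y)` (restricted to the nonnegative axis, where a series with nonnegative coefficients decides its radius);
* `HV.summable_stripBcoeff_of_lt_stripYT` / `HV.not_summable_stripBcoeff_of_stripYT_lt` — the two sides of the radius.

What is NOT here: the printed characterisation `ρ_T(y_T) = x_c` (Cor. 8, second sentence) — an `x`-radius statement needing the
`y`-weighted unfolding of Props 7–8.
-/

noncomputable section

open Finset Filter Topology

namespace Literature.Probability.RandomPlanarGeometry.SAW.HV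

variable {T : ℕ} {y : ℝ}

/-! ### The coefficients of `B_{T,L}(x_c; y)` as a polynomial in `y` -/

/-- `β_{T,L,m} := Σ_{γ ∈ β-walks of S_{T,L}, c(γ) = m} x_c^{|γ|}`, the coefficient of `y^m` in `B_{T,L}(x_c; y)`.
[cite: BeatonBousquetMelouDeGierDuminilCopinGuttmann2014, §3.2 (arXiv v5 p. 12: B_T(x;y) is a series in y with nonnegative coefficients); Corollary 8 (p. 12)] -/
def stripBcoeffY (T L m : ℕ) : ℝ :=
  ∑ P ∈ ((midWalks (stripV T L)).filter (fun P => IsBetaDart T (finalDart P))).filter (fun P => surfContacts T P = m),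
    hexCriticalFugacity ^ mwLen P

/-- `β_{T,L,m} ≥ 0`. [cite: BeatonBousquetMelouDeGierDuminilCopinGuttmann2014, §3.2 (arXiv v5 p. 12)] -/
theorem stripBcoeffY_nonneg (T L m : ℕ) : 0 ≤ stripBcoeffY T L m :=
  sum_nonneg fun _ _ => pow_nonneg hexCriticalFugacity_pos_lt_one.1.le _

/-- `β_{T,L,m}` increases with `L` (larger boxes carry more walks). [cite: BeatonBousquetMelouDeGierDuminilCopinGuttmann2014, §4.2 (arXiv v5 p. 14: "they increase with L")] -/
theorem stripBcoeffY_mono_L {T L L' : ℕ} (h : L ≤ L') (m : ℕ) : stripBcoeffY T L m ≤ stripBcoeffY T L' m := by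
  unfold stripBcoeffY
  exact sum_le_sum_of_subset_of_nonneg
    (filter_subset_filter _ (filter_subset_filter _ (midWalks_mono (stripV_mono_L h))))
    fun _ _ _ => pow_nonneg hexCriticalFugacity_pos_lt_one.1.le _

/-- **`B_{T,L}(x_c; y) = Σ_m β_{T,L,m} y^m`** (a polynomial in `y` with nonnegative coefficients).
[cite: BeatonBousquetMelouDeGierDuminilCopinGuttmann2014, §3.2 (arXiv v5 p. 12)] -/
theorem hasSum_stripBcoeffY (T L : ℕ) (y : ℝ) :
    HasSum (fun m => stripBcoeffY T L m * y ^ m) (stripGFy T L (IsBetaDart T) y) := by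
  set W := (midWalks (stripV T L)).filter (fun P => IsBetaDart T (finalDart P)) with hW
  have h1 : stripGFy T L (IsBetaDart T) y = ∑ m ∈ W.image (surfContacts T), stripBcoeffY T L m * y ^ m := by
    rw [stripGFy, ← hW, ← Finset.sum_fiberwise_of_maps_to (g := surfContacts T) (t := W.image (surfContacts T))
      (fun P hP => mem_image_of_mem _ hP)]
    refine sum_congr rfl fun m _ => ?_
    rw [stripBcoeffY, ← hW, sum_mul]
    refine sum_congr rfl fun P hP => ?_
    rw [(mem_filter.1 hP).2]
  rw [h1]
  refine hasSum_sum_of_ne_finset_zero fun m hm => ?_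
  have h0 : stripBcoeffY T L m = 0 := by
    rw [stripBcoeffY, ← hW]
    exact sum_eq_zero fun P hP => (hm (mem_image.2 ⟨P, (mem_filter.1 hP).1, (mem_filter.1 hP).2⟩)).elim
  rw [h0, zero_mul]

/-- `β_{T,L,m} ≤ B_{T,L}(x_c; 1) = B_{T,L}(x_c)`. [cite: BeatonBousquetMelouDeGierDuminilCopinGuttmann2014, §3.2 (arXiv v5 p. 12)] -/
theorem stripBcoeffY_le_stripGFy_one (T L m : ℕ) : stripBcoeffY T L m ≤ stripGFy T L (IsBetaDart T) 1 := by
  have h := le_hasSum (hasSum_stripBcoeffY T L 1) m fun j _ => by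
    simpa using stripBcoeffY_nonneg T L j
  simpa using h

/-- `1 < y* = 1 + √2`. [cite: BeatonBousquetMelouDeGierDuminilCopinGuttmann2014, Theorem 10 (arXiv v5 p. 14: y* = 1 + √2)] -/
theorem one_lt_yStar : 1 < yStar := by
  unfold yStar; have := Real.sqrt_pos.2 (show (0:ℝ) < 2 by norm_num); linarith

/-- The coefficients are bounded in `L` (`T ≥ 1`; by the `y = 1` bound). [cite: BeatonBousquetMelouDeGierDuminilCopinGuttmann2014, §4.2, eq. (17) (arXiv v5 p. 14)] -/
theorem bddAbove_stripBcoeffY (hT : 1 ≤ T) (m : ℕ) : BddAbove (Set.range fun L : ℕ => stripBcoeffY T L m) := by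
  obtain ⟨K, hK⟩ := (mem_stripBddSet_of_lt hT one_pos one_lt_yStar).2
  exact ⟨K, by rintro _ ⟨L, rfl⟩; exact (stripBcoeffY_le_stripGFy_one T L m).trans (hK ⟨L, rfl⟩)⟩

/-! ### The coefficients `β_{T,m}` of `B_T(x_c; y)` -/

/-- **`β_{T,m} := sup_L β_{T,L,m}`**, the coefficient of `y^m` in `B_T(x_c; y)` (monotone limit in the box length).
[cite: BeatonBousquetMelouDeGierDuminilCopinGuttmann2014, Corollary 8 (arXiv v5 p. 12: "The series (in y) … B_T(x_c; y) … have radius of convergence y_T")] -/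
def stripBcoeff (T m : ℕ) : ℝ := ⨆ L : ℕ, stripBcoeffY T L m

/-- `β_{T,L,m} → β_{T,m}` as `L → ∞` (`T ≥ 1`). [cite: BeatonBousquetMelouDeGierDuminilCopinGuttmann2014, Corollary 8 (arXiv v5 p. 12)] -/
theorem tendsto_stripBcoeffY (hT : 1 ≤ T) (m : ℕ) :
    Tendsto (fun L : ℕ => stripBcoeffY T L m) atTop (𝓝 (stripBcoeff T m)) :=
  tendsto_atTop_ciSup (fun _ _ h => stripBcoeffY_mono_L h m) (bddAbove_stripBcoeffY hT m)

/-- `β_{T,L,m} ≤ β_{T,m}`. [cite: BeatonBousquetMelouDeGierDuminilCopinGuttmann2014, Corollary 8 (arXiv v5 p. 12)] -/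
theorem stripBcoeffY_le_stripBcoeff (hT : 1 ≤ T) (L m : ℕ) : stripBcoeffY T L m ≤ stripBcoeff T m :=
  le_ciSup (bddAbove_stripBcoeffY hT m) L

/-- `β_{T,m} ≥ 0`. [cite: BeatonBousquetMelouDeGierDuminilCopinGuttmann2014, Corollary 8 (arXiv v5 p. 12)] -/
theorem stripBcoeff_nonneg (hT : 1 ≤ T) (m : ℕ) : 0 ≤ stripBcoeff T m :=
  (stripBcoeffY_nonneg T 0 m).trans (stripBcoeffY_le_stripBcoeff hT 0 m)

/-- Every `B_{T,L}(x_c; y)` lies below the series `Σ_m β_{T,m} y^m` whenever the latter converges (`y ≥ 0`).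
[cite: BeatonBousquetMelouDeGierDuminilCopinGuttmann2014, Corollary 8 (arXiv v5 p. 12)] -/
theorem stripGFy_le_tsum_stripBcoeff (hT : 1 ≤ T) (hy0 : 0 ≤ y) (hs : Summable fun m => stripBcoeff T m * y ^ m) (L : ℕ) :
    stripGFy T L (IsBetaDart T) y ≤ ∑' m, stripBcoeff T m * y ^ m :=
  hasSum_le (fun m => mul_le_mul_of_nonneg_right (stripBcoeffY_le_stripBcoeff hT L m) (pow_nonneg hy0 m))
    (hasSum_stripBcoeffY T L y) hs.hasSum

/-! ### On the boundedness set the series converges to `B_T(x_c; y)`; off it, it diverges -/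

/-- **Convergence on the boundedness set, with the value**: for `y ∈ stripBddSet T` (`T ≥ 1`) the series `Σ_m β_{T,m} y^m`
converges and its sum is `B_T(x_c; y) = sup_L B_{T,L}(x_c; y)` (`HV.stripByLim`).
[cite: BeatonBousquetMelouDeGierDuminilCopinGuttmann2014, Corollary 8 (arXiv v5 p. 12: radius of convergence y_T); GlazmanManolescu2019, Proposition 1.2 (arXiv v3 p. 6)] -/
theorem hasSum_stripBcoeff_of_mem (hT : 1 ≤ T) (hy : y ∈ stripBddSet T) :
    HasSum (fun m => stripBcoeff T m * y ^ m) (stripByLim T y) := by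
  obtain ⟨hy0, hbdd⟩ := hy
  have hf0 : ∀ m, 0 ≤ stripBcoeff T m * y ^ m := fun m => mul_nonneg (stripBcoeff_nonneg hT m) (pow_nonneg hy0 m)
  -- the partial sums are limits in `L` of partial sums of `B_{T,L}`, hence `≤ sup_L B_{T,L}`
  have hpart : ∀ n, ∑ m ∈ Finset.range n, stripBcoeff T m * y ^ m ≤ stripByLim T y := by
    intro n
    have hlim : Tendsto (fun L : ℕ => ∑ m ∈ Finset.range n, stripBcoeffY T L m * y ^ m) atTop
        (𝓝 (∑ m ∈ Finset.range n, stripBcoeff T m * y ^ m)) :=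
      tendsto_finsetSum _ fun m _ => (tendsto_stripBcoeffY hT m).mul_const _
    refine le_of_tendsto' hlim fun L => ?_
    calc ∑ m ∈ Finset.range n, stripBcoeffY T L m * y ^ m ≤ stripGFy T L (IsBetaDart T) y :=
          sum_le_hasSum (Finset.range n) (fun m _ => mul_nonneg (stripBcoeffY_nonneg T L m) (pow_nonneg hy0 m))
            (hasSum_stripBcoeffY T L y)
      _ ≤ stripByLim T y := le_ciSup hbdd L
  have hsum : Summable fun m => stripBcoeff T m * y ^ m := summable_of_sum_range_le hf0 hpart
  have h1 : ∑' m, stripBcoeff T m * y ^ m ≤ stripByLim T y := Real.tsum_le_of_sum_range_le hf0 hpart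
  have h2 : stripByLim T y ≤ ∑' m, stripBcoeff T m * y ^ m := by
    unfold stripByLim
    exact ciSup_le fun L => stripGFy_le_tsum_stripBcoeff hT hy0 hsum L
  have h3 : stripByLim T y = ∑' m, stripBcoeff T m * y ^ m := le_antisymm h2 h1
  rw [h3]
  exact hsum.hasSum

/-- On the boundedness set the series converges. [cite: BeatonBousquetMelouDeGierDuminilCopinGuttmann2014, Corollary 8 (arXiv v5 p. 12)] -/
theorem summable_stripBcoeff_of_mem (hT : 1 ≤ T) (hy : y ∈ stripBddSet T) : Summable fun m => stripBcoeff T m * y ^ m :=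
  (hasSum_stripBcoeff_of_mem hT hy).summable

/-- On the boundedness set, `B_T(x_c; y) = Σ_m β_{T,m} y^m`. [cite: BeatonBousquetMelouDeGierDuminilCopinGuttmann2014, Corollary 8 (arXiv v5 p. 12)] -/
theorem stripByLim_eq_tsum (hT : 1 ≤ T) (hy : y ∈ stripBddSet T) : stripByLim T y = ∑' m, stripBcoeff T m * y ^ m :=
  (hasSum_stripBcoeff_of_mem hT hy).tsum_eq.symm

/-- **Divergence off the boundedness set**: if `L ↦ B_{T,L}(x_c; y)` is unbounded (`y ≥ 0`, `T ≥ 1`) the series `Σ_m β_{T,m} y^m`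
diverges. [cite: BeatonBousquetMelouDeGierDuminilCopinGuttmann2014, Corollary 8 (arXiv v5 p. 12)] -/
theorem not_summable_stripBcoeff (hT : 1 ≤ T) (hy0 : 0 ≤ y)
    (hnb : ¬ BddAbove (Set.range fun L : ℕ => stripGFy T L (IsBetaDart T) y)) :
    ¬ Summable fun m => stripBcoeff T m * y ^ m := fun hs =>
  hnb ⟨∑' m, stripBcoeff T m * y ^ m, by
    rintro _ ⟨L, rfl⟩
    exact stripGFy_le_tsum_stripBcoeff hT hy0 hs L⟩

/-! ### `y_T` = the radius of convergence -/

/-- **The boundedness set is the convergence set**: `stripBddSet T = {y ≥ 0 : Σ_m β_{T,m} y^m converges}` (`T ≥ 1`).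
[cite: BeatonBousquetMelouDeGierDuminilCopinGuttmann2014, Corollary 8 (arXiv v5 p. 12: "The series (in y) A_T(x_c;y), B_T(x_c;y) and C_T(x_c;y) have radius of convergence y_T"); GlazmanManolescu2019, Proposition 1.2 (arXiv v3 p. 6: "y_c(T,Θ) is equal to the radius of convergence of B_{T,Θ}(1;y)")] -/
theorem stripBddSet_eq_summable (hT : 1 ≤ T) :
    stripBddSet T = {y : ℝ | 0 ≤ y ∧ Summable fun m => stripBcoeff T m * y ^ m} := by
  ext y
  constructor
  · exact fun hy => ⟨hy.1, summable_stripBcoeff_of_mem hT hy⟩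
  · rintro ⟨hy0, hs⟩
    by_contra h
    exact not_summable_stripBcoeff hT hy0 (fun hb => h ⟨hy0, hb⟩) hs

/-- **`y_T` is the radius of convergence of `B_T(x_c; y) = Σ_m β_{T,m} y^m`** (on the nonnegative axis):
`stripYT T = sup {y ≥ 0 : Σ_m β_{T,m} y^m converges}` (`T ≥ 1`) — the capstone's READING of the lane definition, now a theorem.
[cite: BeatonBousquetMelouDeGierDuminilCopinGuttmann2014, Corollary 8 (arXiv v5 p. 12: "The series (in y) A_T(x_c;y), B_T(x_c;y) and C_T(x_c;y) have radius of convergence y_T"); GlazmanManolescu2019, Proposition 1.2 (arXiv v3 p. 6)] -/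
theorem stripYT_eq_sSup_summable (hT : 1 ≤ T) :
    stripYT T = sSup {y : ℝ | 0 ≤ y ∧ Summable fun m => stripBcoeff T m * y ^ m} := by
  rw [stripYT, stripBddSet_eq_summable hT]

/-- The boundedness set is an initial segment of `[0, ∞)`. [cite: BeatonBousquetMelouDeGierDuminilCopinGuttmann2014, §3.2 (arXiv v5 p. 12: nonnegative coefficients)] -/
theorem mem_stripBddSet_of_le_mem {y y' : ℝ} (hy' : y' ∈ stripBddSet T) (hy0 : 0 ≤ y) (h : y ≤ y') : y ∈ stripBddSet T := by
  obtain ⟨K, hK⟩ := hy'.2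
  exact ⟨hy0, ⟨K, by rintro _ ⟨L, rfl⟩; exact (stripGFy_mono T L _ hy0 h).trans (hK ⟨L, rfl⟩)⟩⟩

/-- Below `y_T` every `y ≥ 0` is in the boundedness set. [cite: BeatonBousquetMelouDeGierDuminilCopinGuttmann2014, Corollary 8 (arXiv v5 p. 12)] -/
theorem mem_stripBddSet_of_lt_stripYT (hT : 1 ≤ T) (hy0 : 0 ≤ y) (h : y < stripYT T) : y ∈ stripBddSet T := by
  obtain ⟨y', hy', hlt⟩ := exists_lt_of_lt_csSup ⟨1, mem_stripBddSet_of_lt hT one_pos one_lt_yStar⟩ h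
  exact mem_stripBddSet_of_le_mem hy' hy0 hlt.le

/-- **Inside the radius**: for `0 ≤ y < y_T` the series converges, to `B_T(x_c; y)`.
[cite: BeatonBousquetMelouDeGierDuminilCopinGuttmann2014, Corollary 8 (arXiv v5 p. 12)] -/
theorem hasSum_stripBcoeff_of_lt_stripYT (hT : 1 ≤ T) (hy0 : 0 ≤ y) (h : y < stripYT T) :
    HasSum (fun m => stripBcoeff T m * y ^ m) (stripByLim T y) :=
  hasSum_stripBcoeff_of_mem hT (mem_stripBddSet_of_lt_stripYT hT hy0 h)

/-- Inside the radius the series converges. [cite: BeatonBousquetMelouDeGierDuminilCopinGuttmann2014, Corollary 8 (arXiv v5 p. 12)] -/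
theorem summable_stripBcoeff_of_lt_stripYT (hT : 1 ≤ T) (hy0 : 0 ≤ y) (h : y < stripYT T) :
    Summable fun m => stripBcoeff T m * y ^ m :=
  (hasSum_stripBcoeff_of_lt_stripYT hT hy0 h).summable

/-- **Outside the radius**: for `y > y_T` the series diverges. [cite: BeatonBousquetMelouDeGierDuminilCopinGuttmann2014, Corollary 8 (arXiv v5 p. 12)] -/
theorem not_summable_stripBcoeff_of_stripYT_lt (hT : 1 ≤ T) (h : stripYT T < y) :
    ¬ Summable fun m => stripBcoeff T m * y ^ m := by
  have hy0 : 0 ≤ y := (yStar_pos.le.trans (yStar_le_stripYT hT)).trans h.le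
  refine not_summable_stripBcoeff hT hy0 fun hb => ?_
  have := le_csSup (stripBddSet_bddAbove hT) ⟨hy0, hb⟩
  unfold stripYT at h
  linarith

/-- At `y = 1` the series sums to the tree's `B_T(x_c)` (`HV.stripBlim`). [cite: DuminilCopinSmirnov2012, §3 (B_T^{x_c} and its limit in the strip); BeatonBousquetMelouDeGierDuminilCopinGuttmann2014, §4.2 eq. (17)] -/
theorem hasSum_stripBcoeff_one (hT : 1 ≤ T) : HasSum (fun m => stripBcoeff T m) (stripBlim T) := by
  have h := hasSum_stripBcoeff_of_mem hT (mem_stripBddSet_of_lt hT one_pos one_lt_yStar)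
  rw [stripByLim_one] at h
  simpa using h

end Literature.Probability.RandomPlanarGeometry.SAW.HV
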